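import Literature.NumberTheory.Automorphic.RegularAlgebraicCuspidalHeckePointProofs
import Summits.Langlands.Langlands.Theses.ParityBlindBianchi
import HarnessLib

/-!
# `TwoAdicBianchiProModularityLevel` (crux stmt-Langlands-15110, route `ParityBlindBianchi`) —
# the points of `Spf 𝕋(Kᵖ)` form a `ϖ`-ADICALLY CLOSED set (limit closure of `IsHeckePoint`)

Generic vocabulary of `Literature.NumberTheory.Automorphic.CompletedCohomology`: a coefficient ring
`k` with `ϖ ∈ k`, `Γ → 𝒢`, a tower of levels `T`, Hecke elements `δ : J → 𝒢`, values `χ : J → k`.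
By the kernel description of points (`isHeckePoint_iff_forall_freeAlgebra`: `χ` is a point iff for
every `t` the non-commutative polynomials in the `T_{δ j}` vanishing on finitely many pieces of the
tower take values in `(ϖ^t)` at `χ`), the stage-`t` condition only reads `χ` modulo `ϖ^t`.  Hence:

* `IsHeckePoint.of_forall_exists_congr` — **if for every `t` some point `χ_t` of `Spf 𝕋(Kᵖ)` is
  congruent to `χ` modulo `ϖ^t` (value by value on `J`), then `χ` is a point**: the `k`-points of
  `Spf 𝕋(Kᵖ)` are closed for the `ϖ`-adic topology of `k^J` (uniform congruence on all of `J`);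
  `isHeckePoint_iff_forall_exists_congr`, `IsHeckePoint.of_seq` (limits of sequences of points),
  `IsHeckePoint.congr_mod` (points only depend on `χ` modulo `⋂_t (ϖ^t)`).
* `mem_span_pow_iff_norm_le` — the dictionary for `k = ℤ̄_p` (valuation ring of `ℚ̄_p`, `ϖ = p`):
  `x ∈ (p^t) ↔ ‖x‖ ≤ ‖p‖^t`.
* `crux_isHeckePoint_of_limit` (registered sub-goal) — the crux's literal setting (`Γ = GL₂(K) → GL₂(𝔸_K^∞)`, the tower
  `U ∩ K((2)^r)`, Hecke family `(v,i) ↦ (t_{v,i+1})_f` over the good places, `k = ℤ̄₂`, `ϖ = 2`):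
  Hecke data `a` that are, at ONE tame level `U`, `2`-adic limits of points `b_t`
  (`‖b_t − a‖ ≤ ‖2‖^t` at every good place) are a point.
* `stub_artinLift_iff_limitForm` — consequently the registered open stub B (`stub_artinLift`: big
  `R = 𝕋` for `GL₂/K`, `l₀ = 1`, `p = 2`, read at the Artin point) is EQUIVALENT to its limit form
  B_lim, in which the conclusion "the Hansen data `a` of `σ` are a point of `Spf 𝕋(U²)`" is replaced
  by "`a` is a `2`-adic limit, at one tame level `U`, of points of `Spf 𝕋(U²)`" — classical points
  (regular algebraic cuspidal `π_t ≡ σ (mod 2^t)` of tame level `U`, through the Literature named fact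
  `bianchi_regularAlgebraicCuspidal_isHeckePoint`: the characteristic-`0` shadow, expected off
  CM/base-change components to be unavailable — Calegari–Mazur) or torsion points alike.  This is the
  formal closing mechanism of the route's foreseen calibration child (`σ = ρ′|_K ⊗ χ`, `ρ′` odd,
  through `Λ`-adic base change: lead c7's report) and of lead c6's CM sanity check, and the precise
  sense in which B is a statement about the CLOSURE of the classical/torsion eigensystems of level `U`.

Sorry-free, definition-free; lead c9 (line `Sketch`, cycle 10).
-/

noncomputable section

set_option linter.dupNamespace false

namespace Summit.Langlands.Langlands.Theorems.TwoAdicBianchiProModularityLevel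

open Literature.NumberTheory.Automorphic

universe u v

/-! ### Generic: `Spf 𝕋(Kᵖ)(k)` is `ϖ`-adically closed in `k^J` -/

section Generic

variable {k : Type u} [CommRing k] {Γ 𝒢 : Type u} [Group Γ] [Group 𝒢]
  {ι : Γ →* 𝒢} {T : LevelTower 𝒢} {ϖ : k} {J : Type v} {δ : J → 𝒢}

omit [Group Γ] [Group 𝒢] in
/-- Evaluation of non-commutative polynomials respects congruences: if `χ ≡ χ'` modulo an ideal `I`
value by value, then `P(χ) ≡ P(χ') (mod I)` for every `P` in the free `k`-algebra on `J`. [folklore] -/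
theorem freeAlgebra_lift_sub_lift_mem (I : Ideal k) {χ χ' : J → k} (h : ∀ j, χ j - χ' j ∈ I)
    (P : FreeAlgebra k J) : FreeAlgebra.lift k χ P - FreeAlgebra.lift k χ' P ∈ I := by
  have hcomp : (Ideal.Quotient.mkₐ k I).comp (FreeAlgebra.lift k χ) =
      (Ideal.Quotient.mkₐ k I).comp (FreeAlgebra.lift k χ') := by
    refine FreeAlgebra.hom_ext (funext fun j => ?_)
    simp only [Function.comp_apply, AlgHom.comp_apply, FreeAlgebra.lift_ι_apply,
      Ideal.Quotient.mkₐ_eq_mk]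
    exact Ideal.Quotient.eq.mpr (h j)
  have hP := AlgHom.congr_fun hcomp P
  simp only [AlgHom.comp_apply, Ideal.Quotient.mkₐ_eq_mk] at hP
  exact Ideal.Quotient.eq.mp hP

/-- **`Spf 𝕋(Kᵖ)(k)` is `ϖ`-adically closed.**  If for every `t` there is a point `χ_t` of the big
Hecke algebra of the tower with `χ_t j ≡ χ j (mod ϖ^t)` for all `j ∈ J`, then `χ` itself is a
point: the stage-`t` condition of `IsHeckePoint` (`isHeckePoint_iff_forall_freeAlgebra`) only reads
`χ` modulo `ϖ^t`, and `P(χ) ≡ P(χ_t) (mod ϖ^t)` for every non-commutative polynomial `P`. [folklore] -/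
theorem IsHeckePoint.of_forall_exists_congr {χ : J → k}
    (h : ∀ t : ℕ, ∃ χ' : J → k, IsHeckePoint ι T ϖ δ χ' ∧ ∀ j, χ' j - χ j ∈ Ideal.span {ϖ ^ t}) :
    IsHeckePoint ι T ϖ δ χ := by
  rw [isHeckePoint_iff_forall_freeAlgebra]
  intro t
  obtain ⟨χ', hχ', hcong⟩ := h t
  obtain ⟨I, hI⟩ := (isHeckePoint_iff_forall_freeAlgebra.mp hχ') t
  refine ⟨I, fun P hP => ?_⟩
  have h₁ := hI P hP
  have h₂ := freeAlgebra_lift_sub_lift_mem (Ideal.span {ϖ ^ t}) hcong P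
  have h₃ := Ideal.sub_mem _ h₁ h₂
  rwa [sub_sub_cancel] at h₃

/-- Points of `Spf 𝕋(Kᵖ)` only depend on the values modulo `⋂_t (ϖ^t)`: if `χ'` is a point and
`χ' j ≡ χ j` modulo every `ϖ^t`, then `χ` is a point (for `ϖ`-adically separated `k` this is just
`χ' = χ`). [folklore] -/
theorem IsHeckePoint.congr_mod {χ χ' : J → k} (h : IsHeckePoint ι T ϖ δ χ')
    (hc : ∀ (t : ℕ) (j : J), χ' j - χ j ∈ Ideal.span {ϖ ^ t}) : IsHeckePoint ι T ϖ δ χ :=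
  IsHeckePoint.of_forall_exists_congr fun t => ⟨χ', h, hc t⟩

/-- **Limits of points are points.**  If `b : ℕ → (J → k)` is a sequence of points of `Spf 𝕋(Kᵖ)`
converging to `χ` `ϖ`-adically and uniformly on `J` (for every `t` some `b m` is congruent to `χ`
modulo `ϖ^t` at every `j`), then `χ` is a point. [folklore] -/
theorem IsHeckePoint.of_seq {χ : J → k} (b : ℕ → J → k) (hb : ∀ m, IsHeckePoint ι T ϖ δ (b m))
    (hlim : ∀ t : ℕ, ∃ m : ℕ, ∀ j, b m j - χ j ∈ Ideal.span {ϖ ^ t}) :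
    IsHeckePoint ι T ϖ δ χ :=
  IsHeckePoint.of_forall_exists_congr fun t => by
    obtain ⟨m, hm⟩ := hlim t
    exact ⟨b m, hb m, hm⟩

/-- `χ` is a point of `Spf 𝕋(Kᵖ)` iff it is a `ϖ`-adic limit of points (uniformly on `J`).
[folklore] -/
theorem isHeckePoint_iff_forall_exists_congr {χ : J → k} :
    IsHeckePoint ι T ϖ δ χ ↔
      ∀ t : ℕ, ∃ χ' : J → k, IsHeckePoint ι T ϖ δ χ' ∧ ∀ j, χ' j - χ j ∈ Ideal.span {ϖ ^ t} :=
  ⟨fun h t => ⟨χ, h, fun j => by rw [sub_self]; exact Ideal.zero_mem _⟩,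
    IsHeckePoint.of_forall_exists_congr⟩

end Generic

/-! ### The dictionary `(p^t) ↔ ‖·‖ ≤ ‖p‖^t` in `ℤ̄_p` -/

section Padic

variable (p : ℕ) [Fact p.Prime]

/-- In the valuation ring `ℤ̄_p` of `ℚ̄_p` (the coefficient ring of the crux, `p = 2`):
`x ∈ (p^t)` iff `‖x‖ ≤ ‖p‖^t` (`ℤ̄_p` is a valuation ring: `x = p^t · (x / p^t)` with `x / p^t`
integral exactly when `‖x‖ ≤ ‖p‖^t`). [folklore] -/
theorem mem_span_pow_iff_norm_le (t : ℕ) (x : (PadicAlgCl.valued p).v.valuationSubring) :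
    x ∈ Ideal.span {((p : ℕ) : (PadicAlgCl.valued p).v.valuationSubring) ^ t} ↔
      ‖(x : PadicAlgCl p)‖ ≤ ‖(p : PadicAlgCl p)‖ ^ t := by
  have hv : ∀ z : PadicAlgCl p, Valued.v z ≤ 1 ↔ ‖z‖ ≤ 1 := fun z => by
    rw [PadicAlgCl.valuation_def, ← NNReal.coe_le_coe, coe_nnnorm, NNReal.coe_one]
  have hp0 : (p : PadicAlgCl p) ≠ 0 := Nat.cast_ne_zero.mpr (Fact.out : p.Prime).ne_zero
  have hpt : ‖(p : PadicAlgCl p)‖ ^ t ≠ 0 := pow_ne_zero _ (norm_ne_zero_iff.mpr hp0)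
  have hcoe : ∀ y : (PadicAlgCl.valued p).v.valuationSubring,
      (((((p : ℕ) : (PadicAlgCl.valued p).v.valuationSubring) ^ t * y :
        (PadicAlgCl.valued p).v.valuationSubring)) : PadicAlgCl p) =
        (p : PadicAlgCl p) ^ t * (y : PadicAlgCl p) := fun y => by
    push_cast
    rfl
  rw [Ideal.mem_span_singleton]
  constructor
  · rintro ⟨y, rfl⟩
    have hy : ‖(y : PadicAlgCl p)‖ ≤ 1 := (hv _).mp y.2
    rw [hcoe, norm_mul, norm_pow]
    exact mul_le_of_le_one_right (pow_nonneg (norm_nonneg _) _) hy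
  · intro hx
    have hy : ‖(x : PadicAlgCl p) / (p : PadicAlgCl p) ^ t‖ ≤ 1 := by
      rw [norm_div, norm_pow, div_le_one (lt_of_le_of_ne (pow_nonneg (norm_nonneg _) _) hpt.symm)]
      exact hx
    refine ⟨⟨(x : PadicAlgCl p) / (p : PadicAlgCl p) ^ t, (hv _).mpr hy⟩, Subtype.ext ?_⟩
    rw [hcoe]
    exact (mul_div_cancel₀ _ (pow_ne_zero _ hp0)).symm

/-- Norm form of the congruence: `‖x - y‖ ≤ ‖p‖^t` iff `x - y ∈ (p^t)` in `ℤ̄_p`. [folklore] -/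
theorem sub_mem_span_pow_iff_norm_sub_le (t : ℕ) (x y : (PadicAlgCl.valued p).v.valuationSubring) :
    x - y ∈ Ideal.span {((p : ℕ) : (PadicAlgCl.valued p).v.valuationSubring) ^ t} ↔
      ‖(x : PadicAlgCl p) - (y : PadicAlgCl p)‖ ≤ ‖(p : PadicAlgCl p)‖ ^ t := by
  rw [mem_span_pow_iff_norm_le]
  push_cast
  exact Iff.rfl

end Padic

/-! ### The crux's setting: `2`-adic limits of points of `Spf 𝕋(U²)` are points -/

section Crux

open scoped NumberField
open IsDedekindDomain

/-- **`2`-adic limits of points are points, in the crux's vocabulary** (registered sub-goal).  For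
`Γ = GL₂(K) → GL₂(𝔸_K^∞)` diagonally, ANY tower `T` (for the crux: `K(s) = U ∩ K((2)^s)`), the Hecke
family `(v, i) ↦ (t_{v,i+1})_f` over a type `S` of places (the good places), coefficients `ℤ̄₂`,
`ϖ = 2`: if for every `t` there are `ℤ̄₂`-valued Hecke data `b` forming a point of `Spf 𝕋` with
`‖b_{v,i} − a_{v,i}‖ ≤ ‖2‖^t` at every `(v, i)`, then `a` is a point of `Spf 𝕋`.  (The crux's residual
hypothesis is the single stage `‖b − a‖ < 1`; B = `stub_artinLift` asks for the point `a` itself; this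
lemma says that supplying better and better approximating points — classical or torsion — at ONE level
is enough.) [folklore] -/
theorem crux_isHeckePoint_of_limit : ∀ (K : Type) [Field K] [NumberField K]
    (T : LevelTower (GL (Fin 2) (FiniteAdeleRing (𝓞 K) K))) (S : Type)
    (pl : S → HeightOneSpectrum (𝓞 K)) (ϖ : ∀ v : HeightOneSpectrum (𝓞 K), (v.adicCompletion K)ˣ)
    (a : S → ℕ → (PadicAlgCl.valued 2).v.valuationSubring),
    (∀ t : ℕ, ∃ b : S → ℕ → (PadicAlgCl.valued 2).v.valuationSubring,
      IsHeckePoint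
        (Matrix.GeneralLinearGroup.map (algebraMap K (FiniteAdeleRing (𝓞 K) K)) :
          GL (Fin 2) K →* GL (Fin 2) (FiniteAdeleRing (𝓞 K) K))
        T ((2 : ℕ) : (PadicAlgCl.valued 2).v.valuationSubring)
        (fun j : S × Fin 2 => GLn.sndHom 2 K (heckeDiagAt 2 K (pl j.1) (ϖ (pl j.1)) (j.2.val + 1)))
        (fun j => b j.1 (j.2.val + 1)) ∧
      ∀ j : S × Fin 2,
        ‖((b j.1 (j.2.val + 1) : (PadicAlgCl.valued 2).v.valuationSubring) : PadicAlgCl 2) -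
            ((a j.1 (j.2.val + 1) : (PadicAlgCl.valued 2).v.valuationSubring) : PadicAlgCl 2)‖ ≤
          ‖(2 : PadicAlgCl 2)‖ ^ t) →
    IsHeckePoint
      (Matrix.GeneralLinearGroup.map (algebraMap K (FiniteAdeleRing (𝓞 K) K)) :
        GL (Fin 2) K →* GL (Fin 2) (FiniteAdeleRing (𝓞 K) K))
      T ((2 : ℕ) : (PadicAlgCl.valued 2).v.valuationSubring)
      (fun j : S × Fin 2 => GLn.sndHom 2 K (heckeDiagAt 2 K (pl j.1) (ϖ (pl j.1)) (j.2.val + 1)))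
      (fun j => a j.1 (j.2.val + 1)) := by
  intro K _ _ T S pl ϖ a h
  refine IsHeckePoint.of_forall_exists_congr fun t => ?_
  obtain ⟨b, hb, hcong⟩ := h t
  refine ⟨fun j => b j.1 (j.2.val + 1), hb, fun j => ?_⟩
  rw [sub_mem_span_pow_iff_norm_sub_le]
  have h2 : ((2 : ℕ) : PadicAlgCl 2) = (2 : PadicAlgCl 2) := by norm_num
  rw [h2]
  exact hcong j

end Crux

/-! ### B ⇔ B_lim: the open stub `stub_artinLift` in limit form -/

section LimitForm

open scoped NumberField MatrixGroups
open Polynomial IsDedekindDomain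
open Literature.NumberTheory.GaloisRepresentations

/-- **B ⇔ B_lim.**  The registered open stub B = `stub_artinLift` of line `Sketch` (verbatim on the
left: residual occurrence of the icosahedral finite-image `σ` in `Spf 𝕋(U₀²)` implies that the Hansen
data `a` of `σ` are a point of `Spf 𝕋(U²)` at some tame level `U` hyperspecial off `S₀` — big `R = 𝕋`
for `GL₂/K`, `l₀ = 1`, `p = 2`, read at the Artin point) is equivalent to its LIMIT FORM B_lim (on the
right: same hypotheses, conclusion "at some such `U`, for every `t` there is a point `b` of `Spf 𝕋(U²)`
with `‖b − a‖ ≤ ‖2‖^t` at every good place").  `⇒` with `b = a`; `⇐` by `crux_isHeckePoint_of_limit`.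
So B is exactly the statement that the Artin point lies in the `2`-adic CLOSURE, at one tame level, of
the points of the Bianchi big Hecke algebra — e.g. of the classical points supplied by regular algebraic
cuspidal `π_t ≡ σ (mod 2^t)` of level `U` (the characteristic-`0` shadow; Calegari–Mazur predicts these
are unavailable off CM/base-change components) or of torsion points. [cite: GeeNewton2020, §5.1, Conj. 60,
Prop. 62] [cite: CalegariMazur2008, Thm. 1.1, Cor. 1.4] [difficulty: open-problem for either side;
the equivalence itself is folklore] -/
theorem stub_artinLift_iff_limitForm :
    (∀ (K : Type) [Field K] [NumberField K], NumberField.IsTotallyComplex K →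
      Module.finrank ℚ K = 2 →
      (∃ v w : HeightOneSpectrum (𝓞 K), v ≠ w ∧ ((2 : ℕ) : 𝓞 K) ∈ v.asIdeal ∧
        ((2 : ℕ) : 𝓞 K) ∈ w.asIdeal) →
      ∀ (σ : FramedGaloisRep K (PadicAlgCl 2) 2),
      Finite σ.toMonoidHom.range → σ.toGaloisRep.IsIrreducible →
      Nonempty ((Matrix.ProjGenLinGroup.mk.comp σ.toMonoidHom).range ≃* alternatingGroup (Fin 5)) →
      ∀ S₀ : Finset ℕ, 2 ∈ S₀ →
      ∀ (ϖ : ∀ v : HeightOneSpectrum (𝓞 K), (v.adicCompletion K)ˣ),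
      (∀ v : HeightOneSpectrum (𝓞 K),
        Valued.v ((ϖ v : (v.adicCompletion K)ˣ) : v.adicCompletion K) = WithZero.exp (-1 : ℤ)) →
      ∀ (a : {v : HeightOneSpectrum (𝓞 K) // ∀ ℓ ∈ S₀, ((ℓ : ℕ) : 𝓞 K) ∉ v.asIdeal} → ℕ →
        (PadicAlgCl.valued 2).v.valuationSubring),
      (∀ (v : HeightOneSpectrum (𝓞 K)) (hv : ∀ ℓ ∈ S₀, ((ℓ : ℕ) : 𝓞 K) ∉ v.asIdeal),
        σ.IsHeckeAssociatedAt v (fun i : ℕ => if i = 0 then (1 : PadicAlgCl 2) else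
          ((a ⟨v, hv⟩ i : (PadicAlgCl.valued 2).v.valuationSubring) : PadicAlgCl 2))) →
      (∃ U₀ : Subgroup (GL (Fin 2) (FiniteAdeleRing (𝓞 K) K)),
        IsOpen (U₀ : Set (GL (Fin 2) (FiniteAdeleRing (𝓞 K) K))) ∧
        U₀ ≤ glFiniteIntegralLevel 2 K ∧
        (∀ g ∈ glFiniteIntegralLevel 2 K,
          (∀ v : HeightOneSpectrum (𝓞 K), ¬ (∀ ℓ ∈ S₀, ((ℓ : ℕ) : 𝓞 K) ∉ v.asIdeal) →
            ∀ i j : Fin 2, ((g : Matrix (Fin 2) (Fin 2) (FiniteAdeleRing (𝓞 K) K)) i j) v =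
              (1 : Matrix (Fin 2) (Fin 2) (v.adicCompletion K)) i j) → g ∈ U₀) ∧
        ∃ b : {v : HeightOneSpectrum (𝓞 K) // ∀ ℓ ∈ S₀, ((ℓ : ℕ) : 𝓞 K) ∉ v.asIdeal} → ℕ →
            (PadicAlgCl.valued 2).v.valuationSubring,
          (∀ j : {v : HeightOneSpectrum (𝓞 K) // ∀ ℓ ∈ S₀, ((ℓ : ℕ) : 𝓞 K) ∉ v.asIdeal} × Fin 2,
            ‖((b j.1 (j.2.val + 1) : (PadicAlgCl.valued 2).v.valuationSubring) : PadicAlgCl 2) -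
              ((a j.1 (j.2.val + 1) : (PadicAlgCl.valued 2).v.valuationSubring) : PadicAlgCl 2)‖ < 1) ∧
          IsHeckePoint
            (Matrix.GeneralLinearGroup.map (algebraMap K (FiniteAdeleRing (𝓞 K) K)) :
              GL (Fin 2) K →* GL (Fin 2) (FiniteAdeleRing (𝓞 K) K))
            (LevelTower.ofSeq U₀ (fun r : ℕ =>
              (principalCongruenceLevel 2 K (Ideal.span {((2 : ℕ) : 𝓞 K)} ^ r)).map (GLn.sndHom 2 K)))
            ((2 : ℕ) : (PadicAlgCl.valued 2).v.valuationSubring)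
            (fun j : {v : HeightOneSpectrum (𝓞 K) // ∀ ℓ ∈ S₀, ((ℓ : ℕ) : 𝓞 K) ∉ v.asIdeal} × Fin 2 =>
              GLn.sndHom 2 K (heckeDiagAt 2 K j.1.1 (ϖ j.1.1) (j.2.val + 1)))
            (fun j => b j.1 (j.2.val + 1))) →
      ∃ U : Subgroup (GL (Fin 2) (FiniteAdeleRing (𝓞 K) K)),
        IsOpen (U : Set (GL (Fin 2) (FiniteAdeleRing (𝓞 K) K))) ∧
        U ≤ glFiniteIntegralLevel 2 K ∧
        (∀ g ∈ glFiniteIntegralLevel 2 K,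
          (∀ v : HeightOneSpectrum (𝓞 K), ¬ (∀ ℓ ∈ S₀, ((ℓ : ℕ) : 𝓞 K) ∉ v.asIdeal) →
            ∀ i j : Fin 2, ((g : Matrix (Fin 2) (Fin 2) (FiniteAdeleRing (𝓞 K) K)) i j) v =
              (1 : Matrix (Fin 2) (Fin 2) (v.adicCompletion K)) i j) → g ∈ U) ∧
        IsHeckePoint
          (Matrix.GeneralLinearGroup.map (algebraMap K (FiniteAdeleRing (𝓞 K) K)) :
            GL (Fin 2) K →* GL (Fin 2) (FiniteAdeleRing (𝓞 K) K))
          (LevelTower.ofSeq U (fun r : ℕ =>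
            (principalCongruenceLevel 2 K (Ideal.span {((2 : ℕ) : 𝓞 K)} ^ r)).map (GLn.sndHom 2 K)))
          ((2 : ℕ) : (PadicAlgCl.valued 2).v.valuationSubring)
          (fun j : {v : HeightOneSpectrum (𝓞 K) // ∀ ℓ ∈ S₀, ((ℓ : ℕ) : 𝓞 K) ∉ v.asIdeal} × Fin 2 =>
            GLn.sndHom 2 K (heckeDiagAt 2 K j.1.1 (ϖ j.1.1) (j.2.val + 1)))
          (fun j => a j.1 (j.2.val + 1))) ↔
    (∀ (K : Type) [Field K] [NumberField K], NumberField.IsTotallyComplex K →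
      Module.finrank ℚ K = 2 →
      (∃ v w : HeightOneSpectrum (𝓞 K), v ≠ w ∧ ((2 : ℕ) : 𝓞 K) ∈ v.asIdeal ∧
        ((2 : ℕ) : 𝓞 K) ∈ w.asIdeal) →
      ∀ (σ : FramedGaloisRep K (PadicAlgCl 2) 2),
      Finite σ.toMonoidHom.range → σ.toGaloisRep.IsIrreducible →
      Nonempty ((Matrix.ProjGenLinGroup.mk.comp σ.toMonoidHom).range ≃* alternatingGroup (Fin 5)) →
      ∀ S₀ : Finset ℕ, 2 ∈ S₀ →
      ∀ (ϖ : ∀ v : HeightOneSpectrum (𝓞 K), (v.adicCompletion K)ˣ),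
      (∀ v : HeightOneSpectrum (𝓞 K),
        Valued.v ((ϖ v : (v.adicCompletion K)ˣ) : v.adicCompletion K) = WithZero.exp (-1 : ℤ)) →
      ∀ (a : {v : HeightOneSpectrum (𝓞 K) // ∀ ℓ ∈ S₀, ((ℓ : ℕ) : 𝓞 K) ∉ v.asIdeal} → ℕ →
        (PadicAlgCl.valued 2).v.valuationSubring),
      (∀ (v : HeightOneSpectrum (𝓞 K)) (hv : ∀ ℓ ∈ S₀, ((ℓ : ℕ) : 𝓞 K) ∉ v.asIdeal),
        σ.IsHeckeAssociatedAt v (fun i : ℕ => if i = 0 then (1 : PadicAlgCl 2) else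
          ((a ⟨v, hv⟩ i : (PadicAlgCl.valued 2).v.valuationSubring) : PadicAlgCl 2))) →
      (∃ U₀ : Subgroup (GL (Fin 2) (FiniteAdeleRing (𝓞 K) K)),
        IsOpen (U₀ : Set (GL (Fin 2) (FiniteAdeleRing (𝓞 K) K))) ∧
        U₀ ≤ glFiniteIntegralLevel 2 K ∧
        (∀ g ∈ glFiniteIntegralLevel 2 K,
          (∀ v : HeightOneSpectrum (𝓞 K), ¬ (∀ ℓ ∈ S₀, ((ℓ : ℕ) : 𝓞 K) ∉ v.asIdeal) →
            ∀ i j : Fin 2, ((g : Matrix (Fin 2) (Fin 2) (FiniteAdeleRing (𝓞 K) K)) i j) v =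
              (1 : Matrix (Fin 2) (Fin 2) (v.adicCompletion K)) i j) → g ∈ U₀) ∧
        ∃ b : {v : HeightOneSpectrum (𝓞 K) // ∀ ℓ ∈ S₀, ((ℓ : ℕ) : 𝓞 K) ∉ v.asIdeal} → ℕ →
            (PadicAlgCl.valued 2).v.valuationSubring,
          (∀ j : {v : HeightOneSpectrum (𝓞 K) // ∀ ℓ ∈ S₀, ((ℓ : ℕ) : 𝓞 K) ∉ v.asIdeal} × Fin 2,
            ‖((b j.1 (j.2.val + 1) : (PadicAlgCl.valued 2).v.valuationSubring) : PadicAlgCl 2) -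
              ((a j.1 (j.2.val + 1) : (PadicAlgCl.valued 2).v.valuationSubring) : PadicAlgCl 2)‖ < 1) ∧
          IsHeckePoint
            (Matrix.GeneralLinearGroup.map (algebraMap K (FiniteAdeleRing (𝓞 K) K)) :
              GL (Fin 2) K →* GL (Fin 2) (FiniteAdeleRing (𝓞 K) K))
            (LevelTower.ofSeq U₀ (fun r : ℕ =>
              (principalCongruenceLevel 2 K (Ideal.span {((2 : ℕ) : 𝓞 K)} ^ r)).map (GLn.sndHom 2 K)))
            ((2 : ℕ) : (PadicAlgCl.valued 2).v.valuationSubring)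
            (fun j : {v : HeightOneSpectrum (𝓞 K) // ∀ ℓ ∈ S₀, ((ℓ : ℕ) : 𝓞 K) ∉ v.asIdeal} × Fin 2 =>
              GLn.sndHom 2 K (heckeDiagAt 2 K j.1.1 (ϖ j.1.1) (j.2.val + 1)))
            (fun j => b j.1 (j.2.val + 1))) →
      ∃ U : Subgroup (GL (Fin 2) (FiniteAdeleRing (𝓞 K) K)),
        IsOpen (U : Set (GL (Fin 2) (FiniteAdeleRing (𝓞 K) K))) ∧
        U ≤ glFiniteIntegralLevel 2 K ∧
        (∀ g ∈ glFiniteIntegralLevel 2 K,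
          (∀ v : HeightOneSpectrum (𝓞 K), ¬ (∀ ℓ ∈ S₀, ((ℓ : ℕ) : 𝓞 K) ∉ v.asIdeal) →
            ∀ i j : Fin 2, ((g : Matrix (Fin 2) (Fin 2) (FiniteAdeleRing (𝓞 K) K)) i j) v =
              (1 : Matrix (Fin 2) (Fin 2) (v.adicCompletion K)) i j) → g ∈ U) ∧
        ∀ t : ℕ, ∃ b : {v : HeightOneSpectrum (𝓞 K) // ∀ ℓ ∈ S₀, ((ℓ : ℕ) : 𝓞 K) ∉ v.asIdeal} → ℕ →
            (PadicAlgCl.valued 2).v.valuationSubring,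
          IsHeckePoint
            (Matrix.GeneralLinearGroup.map (algebraMap K (FiniteAdeleRing (𝓞 K) K)) :
              GL (Fin 2) K →* GL (Fin 2) (FiniteAdeleRing (𝓞 K) K))
            (LevelTower.ofSeq U (fun r : ℕ =>
              (principalCongruenceLevel 2 K (Ideal.span {((2 : ℕ) : 𝓞 K)} ^ r)).map (GLn.sndHom 2 K)))
            ((2 : ℕ) : (PadicAlgCl.valued 2).v.valuationSubring)
            (fun j : {v : HeightOneSpectrum (𝓞 K) // ∀ ℓ ∈ S₀, ((ℓ : ℕ) : 𝓞 K) ∉ v.asIdeal} × Fin 2 =>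
              GLn.sndHom 2 K (heckeDiagAt 2 K j.1.1 (ϖ j.1.1) (j.2.val + 1)))
            (fun j => b j.1 (j.2.val + 1)) ∧
          ∀ j : {v : HeightOneSpectrum (𝓞 K) // ∀ ℓ ∈ S₀, ((ℓ : ℕ) : 𝓞 K) ∉ v.asIdeal} × Fin 2,
            ‖((b j.1 (j.2.val + 1) : (PadicAlgCl.valued 2).v.valuationSubring) : PadicAlgCl 2) -
                ((a j.1 (j.2.val + 1) : (PadicAlgCl.valued 2).v.valuationSubring) : PadicAlgCl 2)‖ ≤
              ‖(2 : PadicAlgCl 2)‖ ^ t) := by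
  constructor
  · intro hB K _ _ htc hdeg hsplit σ hfin hirr hA5 S₀ h2 ϖ hϖ a hassoc hocc
    obtain ⟨U, hUo, hUle, hU3, hpt⟩ := hB K htc hdeg hsplit σ hfin hirr hA5 S₀ h2 ϖ hϖ a hassoc hocc
    refine ⟨U, hUo, hUle, hU3, fun t => ⟨a, hpt, fun j => ?_⟩⟩
    rw [sub_self, norm_zero]
    exact pow_nonneg (norm_nonneg _) _
  · intro hL K _ _ htc hdeg hsplit σ hfin hirr hA5 S₀ h2 ϖ hϖ a hassoc hocc
    obtain ⟨U, hUo, hUle, hU3, hlim⟩ := hL K htc hdeg hsplit σ hfin hirr hA5 S₀ h2 ϖ hϖ a hassoc hocc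
    exact ⟨U, hUo, hUle, hU3,
      crux_isHeckePoint_of_limit K _ _ (fun v : {v : HeightOneSpectrum (𝓞 K) //
        ∀ ℓ ∈ S₀, ((ℓ : ℕ) : 𝓞 K) ∉ v.asIdeal} => v.1) ϖ a hlim⟩

end LimitForm

end Summit.Langlands.Langlands.Theorems.TwoAdicBianchiProModularityLevel

end
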